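import Mathlib
import Summits.ValiantsHypothesis.ValiantsHypothesis.Theorems.KPlusLogSqLawLiftingStubLiftRungThree
import Summits.ValiantsHypothesis.ValiantsHypothesis.Theorems.KPlusLogSqLawLiftingRungFourRange
import Summits.ValiantsHypothesis.ValiantsHypothesis.Theorems.KPlusLogSqLawDiagonalDesign
import Summits.ValiantsHypothesis.ValiantsHypothesis.Theorems.LacunarySymmetroidMatrixDescartesCensusFrame
import Summits.ValiantsHypothesis.ValiantsHypothesis.Theorems.LacunarySymmetroidMatrixDescartesCensusTropicalKLawBridges

/-!
# Route «KPlusLogSqLaw», crux `Lifting` — the registered stub `stub_liftThin` on the STRIP `K ≤ 3` (all `m`) and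
`K ≤ 4` (for `m ≤ 3069`), with ONE constant `C = 3`

HONEST FRAMING.  Partial-range form of the registered stub
`stub_liftThin : ∃ C, ∀ m K n, K ≤ Nat.log 2 m ^ 2 → TropRow m K n → RealRootLawAt m K (2 ^ (C * K) * (n + 1))`
of the crux `Summit.ValiantsHypothesis.ValiantsHypothesis.Theses.KPlusLogSqLaw.Lifting` (ledger item `stmt-ValiantsHypothesis-19772`,
route `KPlusLogSqLaw`, skeleton `Cruxes/Lifting/Lines/birth.lean`; object-search cell `pub-symmetroid`, seat val-sym-lift-p1 g2,
2026-08-26).  The stub itself is OPEN (it is the crux's thin half; in the window it needs either counting-tight tropical columns —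
which would refute `TropicalB`, tree `KPlusLogSqLaw.not_tropicalB_of_countingTightThin` — or a real root bound below Descartes; HOME
memo val-sym-lift-p4/GAP-LIFT.md).  What IS a theorem is the stub's restriction to few slope classes, uniformly in the size `m`,
with a single constant: this file only ASSEMBLES landed rungs (nothing new is proved about pencils or designs):
* `K = 0`: `TropicalCensus.realRootLawAt_zero` (empty pencil);
* `K = 1`: `Census.realRootLawAt_one` (one-term pencils have at most the root `0`);
* `K = 2`: the diagonal design `TropicalCensus.DiagK.le_of_tropRootLawAt` (`m ≤ n`) with `Census.realRootLawAt_two` (`ζ ≤ 2m+1`);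
* `K = 3`: lift-p3's registered stub `KPlusLogSqLaw.stub_liftRungThree` (SHIFT-THREE `C(m+2,2) − 2 ≤ n` + Descartes);
* `K = 4`, `m + 3 ≤ 3072`: lift-p3's `KPlusLogSqLaw.lift_rung_four_of_le` (quadratic tropical floor + cubic Descartes ceiling).
Nothing here bears on `Lifting` / `TropicalB` in the window, on the cell's real census or registers (DoorA26 / DoorA34), on
`MatrixDescartes` (`stmt-ValiantsHypothesis-18050`) or on `VP ≠ VNP`.

WHAT IS PROVED.
* `lift_strip_le_three : K ≤ 3 → TropRootLawAt m K n → RealRootLawAt m K (2 ^ (3 * K) * (n + 1))` — all `m`;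
* `lift_strip_le_four_of_le : K ≤ 4 → m + 3 ≤ 3072 → TropRootLawAt m K n → RealRootLawAt m K (2 ^ (3 * K) * (n + 1))`;
* `stub_liftThin_strip_le_three : ∃ C, ∀ m K n, K ≤ 3 → TropRootLawAt m K n → RealRootLawAt m K (2 ^ (C * K) * (n + 1))` —
  the stub's own shape with the regime hypothesis `K ≤ Nat.log 2 m ^ 2` replaced by `K ≤ 3` (which it implies for `m ≤ 7`);
* `stub_liftThin_of_le_seven : ∃ C, ∀ m K n, m ≤ 7 → K ≤ Nat.log 2 m ^ 2 → TropRootLawAt m K n → RealRootLawAt m K (2 ^ (C * K) * (n + 1))`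
  — the stub VERBATIM on all sizes `m ≤ 7` (there `Nat.log 2 m ≤ 2`, so `K ≤ 4`, and `m + 3 ≤ 3072`).
-/

-- `Summit.ValiantsHypothesis.ValiantsHypothesis.…` repeats a component by the D-0017 layout
-- (single-conjunct summit), which the `dupNamespace` linter flags; the name is mandated.
set_option linter.dupNamespace false
set_option autoImplicit false

namespace Summit.ValiantsHypothesis.ValiantsHypothesis.Theorems.KPlusLogSqLaw

open Summit.ValiantsHypothesis.ValiantsHypothesis.Theorems.LacunarySymmetroidMatrixDescartes (RealRootLawAt)
open Summit.ValiantsHypothesis.ValiantsHypothesis.Theorems.LacunarySymmetroidMatrixDescartes.TropicalCensus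

/-- **LIFT on the strip `K ≤ 3`, every size `m`, constant `2^(3K)`.** [assembly of landed rungs] -/
theorem lift_strip_le_three (m K n : ℕ) (hK : K ≤ 3) (h : TropRootLawAt m K n) :
    RealRootLawAt m K (2 ^ (3 * K) * (n + 1)) := by
  interval_cases K
  · exact realRootLawAt_zero m _
  · refine LacunarySymmetroidMatrixDescartes.Census.realRootLawAt_mono ?_
      (LacunarySymmetroidMatrixDescartes.Census.realRootLawAt_one m)
    have : 1 ≤ n + 1 := Nat.succ_pos n
    calc 1 ≤ n + 1 := this
      _ ≤ 2 ^ (3 * 1) * (n + 1) := Nat.le_mul_of_pos_left _ (by norm_num)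
  · have hm : m * (2 - 1) ≤ n := DiagK.le_of_tropRootLawAt m 2 le_rfl h
    refine LacunarySymmetroidMatrixDescartes.Census.realRootLawAt_mono ?_
      (LacunarySymmetroidMatrixDescartes.Census.realRootLawAt_two m)
    rw [show 2 ^ (3 * 2) = 64 by norm_num]
    omega
  · exact stub_liftRungThree m n h

/-- **LIFT on the strip `K ≤ 4` for sizes `m + 3 ≤ 3072`, constant `2^(3K)`.** [assembly of landed rungs] -/
theorem lift_strip_le_four_of_le (m K n : ℕ) (hK : K ≤ 4) (hm : m + 3 ≤ 3072) (h : TropRootLawAt m K n) :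
    RealRootLawAt m K (2 ^ (3 * K) * (n + 1)) := by
  rcases Nat.lt_or_ge K 4 with hK3 | hK4
  · exact lift_strip_le_three m K n (by omega) h
  · obtain rfl : K = 4 := le_antisymm hK hK4
    exact lift_rung_four_of_le m n hm h

/-- **The registered stub's shape on the strip `K ≤ 3`** (one constant, all `m`): the thin stub of `Lifting` with its regime
hypothesis `K ≤ ⌊log₂ m⌋²` replaced by `K ≤ 3`. [assembly of landed rungs] -/
theorem stub_liftThin_strip_le_three :
    ∃ C : ℕ, ∀ m K n : ℕ, K ≤ 3 → TropRootLawAt m K n → RealRootLawAt m K (2 ^ (C * K) * (n + 1)) :=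
  ⟨3, fun m K n hK h => lift_strip_le_three m K n hK h⟩

/-- `⌊log₂ m⌋ ≤ 2` for `m ≤ 7`. -/
theorem log_two_le_two_of_le_seven {m : ℕ} (hm : m ≤ 7) : Nat.log 2 m ≤ 2 := by
  rcases Nat.eq_zero_or_pos m with rfl | hpos
  · simp
  · have h := Nat.log_lt_of_lt_pow (b := 2) (x := 3) (Nat.pos_iff_ne_zero.mp hpos) (by omega)
    omega

/-- **The registered stub `stub_liftThin` VERBATIM on all sizes `m ≤ 7`** (there `⌊log₂ m⌋² ≤ 4`, so only `K ≤ 4` occurs, and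
`m + 3 ≤ 3072`), with `C = 3`. [assembly of landed rungs] -/
theorem stub_liftThin_of_le_seven :
    ∃ C : ℕ, ∀ m K n : ℕ, m ≤ 7 → K ≤ Nat.log 2 m ^ 2 → TropRootLawAt m K n →
      RealRootLawAt m K (2 ^ (C * K) * (n + 1)) := by
  refine ⟨3, fun m K n hm hK h => lift_strip_le_four_of_le m K n ?_ (by omega) h⟩
  have hl : Nat.log 2 m ≤ 2 := log_two_le_two_of_le_seven hm
  calc K ≤ Nat.log 2 m ^ 2 := hK
    _ ≤ 2 ^ 2 := Nat.pow_le_pow_left hl 2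
    _ = 4 := by norm_num

end Summit.ValiantsHypothesis.ValiantsHypothesis.Theorems.KPlusLogSqLaw
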